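import Mathlib
import Literature.Combinatorics.Optimization.GenericPolytopePsdRankLowerBound
import Literature.Barriers.PneNP.ExtendedFormulationYannakakisConverse
import HarnessLib

/-!
# Generic convex polygons exist: worst-case psd rank and extension complexity of `v`-gons

Sources. J. Gouveia, R. Z. Robinson, R. R. Thomas, *Worst-case results for positive semidefinite
rank*, Math. Program. 153 (2015) 201–212 = arXiv:1305.4600 [GouveiaRobinsonThomas2015], §2–3
(p05–p07, held text `paper:arxiv-1305.4600`); S. Fiorini, T. Rothvoß, H. R. Tiwary, *Extended
formulations for polygons*, DCG 48 (2012) = arXiv:1107.0371 [FioriniRothvossTiwary2012], §4 (p07).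

Printed statements (verbatim). GRT §2 (p05): "We call a polytope generic if the coordinates of its
vertices form a set of distinct numbers that are algebraically independent over the rationals …
Theorem 2.1. If `P` is a generic polytope in `ℝⁿ` with `v` vertices, then its psd rank is at least
`(nv)^{1/4}`."  §3 (p06): "The result in the previous section implies that the psd rank of a generic
`v`-gon is at least `(2v)^{1/4}`, while on the other hand, `v` is a trivial upper bound on the psd
rank of any `v`-gon since its slack matrix has size `v × v`. This tells us that the worst case rank
of a `v`-gon lies somewhere between the two."  §3 (p07): "In fact the smallest 'concrete' polygons
known to have psd rank greater than four are the generic polytopes whose lower bounds are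
guaranteed by Theorem 2.1, which in this case is a generic 129-gon."  FRT §4 (p07): "We say that a
polygon in `ℝ²` is generic if the coordinates of its vertices are distinct and form a set that is
algebraically independent over the rationals. Theorem 3. If `P` is a generic convex `n`-gon in `ℝ²`
then `xc(P) ≥ √(2n)`."

The lower bounds are the tree's `GouveiaRobinsonThomas2015_thm21_holds`,
`GouveiaRobinsonThomas2015_thm21_sharp` and `FioriniRothvossTiwary2012_thm3`
(`GenericPolytopePsdRankLowerBound.lean`). What was missing for the printed WORST-CASE readings is
the existence, for every `v ≥ 3`, of a generic convex `v`-gon — asserted implicitly by both sources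
("the worst case rank of a `v`-gon", "a generic 129-gon"). This file PROVES it and records the
worst-case statements (namespace `Literature.Combinatorics.Optimization`, helpers in
`GenericPolygon`):
* `GenericPolygon.exists_algebraicIndependent_mem_Ioo` — algebraically independent (over `ℚ`)
  real families with each member in a prescribed open interval (the reals algebraic over a
  finitely generated subring of `ℝ` are countable, an interval is not; Mathlib's
  `AlgebraicIndependent.option_iff`, `Algebraic.countable`, `Cardinal.mk_Ioo_real`);
* `GenericPolygon.exists_generic_convexPolygon` — for every `v ≥ 3` a family of `v` points of `ℝ²`
  with all `2v` coordinates algebraically independent over `ℚ`, in convex position (every point an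
  extreme point of the hull) and with full-dimensional hull: a perturbation of the parabola points
  `(c, c²)`, `c = 1,…,v`, within `1/(4(v+1))` in each coordinate, each point exposed by the rational
  functional `2c·x₁ − x₂`;
* `exists_polygon_psdRank_ge` — **GRT, worst case (p06)**: for every `v ≥ 3` a convex `v`-gon
  all of whose psd lifts have size `k ≥ (2v)^{1/4}` (and `C(k+1,2) ≥ √(2v)`);
* `exists_polygon_xc_ge` — **FRT Theorem 3, worst case**: a convex `v`-gon all of whose
  slack-form extended formulations have `≥ √(2v)` inequalities;
* `exists_129gon_five_le` — the printed remark (p07): a (generic) 129-gon with no psd lift of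
  size `≤ 4` (`2·129 = 258 > 4⁴`); by the printed intermediate count `nv ≤ C(k+1,2)²` even no psd
  lift of size `≤ 5` (`exists_129gon_six_le`, `C(6,2)² = 225 < 258`), and a generic 51-gon none of
  size `≤ 4` (`exists_51gon_five_le`);
* slack-matrix readings: `GouveiaRobinsonThomas2015_thm21_slack` (via FGPRT Thm. 3.3 =
  `FawziEtAl2015_thm33_holds`), `FioriniRothvossTiwary2012_thm3_nonnegRank` (via Yannakakis =
  `hasEFOfSize_of_complete_nonneg_factorization`), `exists_polygon_slack_ranks_ge`.
-/

noncomputable section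

open Set

namespace Literature.Combinatorics.Optimization

namespace GenericPolygon

open Cardinal

/-! ### G1. Algebraically independent reals in prescribed intervals -/

/-- A finitely generated subalgebra of `ℝ` over `ℚ` is countable. [folklore] -/
private theorem countable_adjoin (m : ℕ) (x : Fin m → ℝ) :
    Countable (Algebra.adjoin ℚ (Set.range x)) := by
  rw [← Cardinal.mk_le_aleph0_iff]
  have hsurj : Function.Surjective (fun p : MvPolynomial (Fin m) ℚ =>
      (⟨MvPolynomial.aeval x p, by rw [Algebra.adjoin_range_eq_range_aeval]; exact ⟨p, rfl⟩⟩ :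
        Algebra.adjoin ℚ (Set.range x))) := by
    rintro ⟨s, hs⟩
    rw [Algebra.adjoin_range_eq_range_aeval] at hs
    obtain ⟨p, rfl⟩ := hs
    exact ⟨p, rfl⟩
  calc #(Algebra.adjoin ℚ (Set.range x)) ≤ #(MvPolynomial (Fin m) ℚ) :=
        Cardinal.mk_le_of_surjective hsurj
    _ ≤ max (max #ℚ #(Fin m)) ℵ₀ := MvPolynomial.cardinalMk_le_max
    _ = ℵ₀ := by simp

/-- One more algebraically independent real, inside any open interval: the reals algebraic over
`ℚ[x_1,…,x_m]` are countable, `(a, b)` is not. [folklore] -/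
private theorem exists_transcendental_mem_Ioo (m : ℕ) (x : Fin m → ℝ) (hx : AlgebraicIndependent ℚ x)
    {a b : ℝ} (hab : a < b) :
    ∃ t ∈ Set.Ioo a b, AlgebraicIndependent ℚ (fun o : Option (Fin m) => o.elim t x) := by
  haveI := countable_adjoin m x
  have hcount := Algebraic.countable (Algebra.adjoin ℚ (Set.range x)) ℝ
  have hunc : ¬ (Set.Ioo a b).Countable := by
    intro hc
    have := hc.le_aleph0
    rw [Cardinal.mk_Ioo_real hab] at this
    exact absurd this (not_le.2 Cardinal.aleph0_lt_continuum)
  obtain ⟨t, ht, hnot⟩ : ∃ t ∈ Set.Ioo a b,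
      t ∉ {y : ℝ | IsAlgebraic (Algebra.adjoin ℚ (Set.range x)) y} := by
    by_contra hcon
    push Not at hcon
    exact hunc (hcount.mono hcon)
  exact ⟨t, ht, AlgebraicIndependent.option_iff.2 ⟨hx, hnot⟩⟩

/-- **Algebraically independent reals in prescribed boxes**: for all open intervals
`(lo_i, hi_i)`, `i < m`, there is a family `t` algebraically independent over `ℚ` with
`t_i ∈ (lo_i, hi_i)` (so algebraically independent tuples are dense; FRT §4 recalls the notions from
[Hungerford, Lang]). [cite: FioriniRothvossTiwary2012, §4 (p07, "algebraically independent over the rationals")] -/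
theorem exists_algebraicIndependent_mem_Ioo :
    ∀ (m : ℕ) (lo hi : Fin m → ℝ), (∀ i, lo i < hi i) →
      ∃ t : Fin m → ℝ, AlgebraicIndependent ℚ t ∧ ∀ i, t i ∈ Set.Ioo (lo i) (hi i) := by
  intro m
  induction m with
  | zero =>
    intro lo hi _
    refine ⟨fun i => i.elim0, ?_, fun i => i.elim0⟩
    exact algebraicIndependent_empty_type_iff.2 (algebraMap ℚ ℝ).injective
  | succ m ih =>
    intro lo hi hlohi
    obtain ⟨t, ht, htI⟩ := ih (fun i => lo i.succ) (fun i => hi i.succ) (fun i => hlohi i.succ)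
    obtain ⟨t₀, ht₀, hind⟩ := exists_transcendental_mem_Ioo m t ht (hlohi 0)
    refine ⟨Fin.cons t₀ t, ?_, fun i => ?_⟩
    · have heq : (Fin.cons t₀ t : Fin (m + 1) → ℝ) =
          (fun o : Option (Fin m) => o.elim t₀ t) ∘ (finSuccEquiv m) := by
        funext i
        refine Fin.cases ?_ (fun j => ?_) i
        · simp [finSuccEquiv_zero]
        · simp [finSuccEquiv_succ]
      rw [heq]
      exact (algebraicIndependent_equiv (finSuccEquiv m)).2 hind
    · refine Fin.cases ?_ (fun j => ?_) i
      · simpa using ht₀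
      · simpa using htI j

/-! ### G2. A generic convex polygon near the parabola -/

variable {v : ℕ}

/-- The abscissa `c_i = i + 1` of the `i`-th parabola point. [cite: FioriniRothvossTiwary2012, Thm. 8 (p09, the set `Z = {(z, z²)}`)] -/
def ctr (i : Fin v) : ℝ := (i : ℝ) + 1

/-- The perturbation radius `δ = 1/(4(v+1))`. [folklore] -/
def rad (v : ℕ) : ℝ := 1 / (4 * ((v : ℝ) + 1))

/-- The target coordinates `(c_i, c_i²)`. [folklore] -/
def tgt (p : Fin v × Fin 2) : ℝ := if p.2 = 0 then ctr p.1 else ctr p.1 ^ 2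

/-- `0 < δ` and `2(2v+1)δ < 1`. [folklore] -/
private theorem rad_bounds (v : ℕ) : 0 < rad v ∧ 2 * (2 * (v : ℝ) + 1) * rad v < 1 ∧ rad v ≤ 1 / 4 := by
  have hv : (0 : ℝ) ≤ v := Nat.cast_nonneg v
  refine ⟨by unfold rad; positivity, ?_, ?_⟩
  · unfold rad
    rw [show 2 * (2 * (v : ℝ) + 1) * (1 / (4 * ((v : ℝ) + 1))) = (2 * v + 1) / (2 * (v + 1)) by
      field_simp; ring]
    rw [div_lt_one (by positivity)]
    linarith
  · unfold rad
    apply one_div_le_one_div_of_le (by norm_num)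
    linarith

/-- A point of a finite family that is the unique maximiser of a rational linear functional among
the family is an extreme point of the convex hull (tree: `GenericPsdRank.eq_of_isMax_dotRat`). [folklore] -/
private theorem mem_extremePoints_of_strict {m : ℕ} (x : Fin v → (Fin m → ℝ)) (i : Fin v)
    (ω : Fin m → ℚ)
    (hω : ∀ j, j ≠ i → GenericPsdRank.dotRat ω (x j) < GenericPsdRank.dotRat ω (x i)) :
    x i ∈ (convexHull ℝ (Set.range x)).extremePoints ℝ := by
  rw [mem_extremePoints]
  refine ⟨subset_convexHull ℝ _ ⟨i, rfl⟩, fun x₁ hx₁ x₂ hx₂ hseg => ?_⟩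
  obtain ⟨a, b, ha, hb, hab, hcomb⟩ := hseg
  have h1 := GenericPsdRank.dotRat_le_of_mem_convexHull x i ω hω hx₁
  have h2 := GenericPsdRank.dotRat_le_of_mem_convexHull x i ω hω hx₂
  have hlin : GenericPsdRank.dotRat ω (x i) =
      a * GenericPsdRank.dotRat ω x₁ + b * GenericPsdRank.dotRat ω x₂ := by
    rw [← hcomb]
    simp only [GenericPsdRank.dotRat, Pi.add_apply, Pi.smul_apply, smul_eq_mul, Finset.mul_sum,
      ← Finset.sum_add_distrib]
    exact Finset.sum_congr rfl fun l _ => by ring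
  have h3 : a * GenericPsdRank.dotRat ω (x i) + b * GenericPsdRank.dotRat ω (x i) =
      GenericPsdRank.dotRat ω (x i) := by rw [← add_mul, hab, one_mul]
  have h1' : GenericPsdRank.dotRat ω (x i) ≤ GenericPsdRank.dotRat ω x₁ := by
    by_contra hlt
    rw [not_le] at hlt
    have := mul_lt_mul_of_pos_left hlt ha
    linarith [mul_le_mul_of_nonneg_left h2 hb.le]
  have h2' : GenericPsdRank.dotRat ω (x i) ≤ GenericPsdRank.dotRat ω x₂ := by
    by_contra hlt
    rw [not_le] at hlt
    have := mul_lt_mul_of_pos_left hlt hb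
    linarith [mul_le_mul_of_nonneg_left h1 ha.le]
  exact ⟨GenericPsdRank.eq_of_isMax_dotRat x i ω hω hx₁ h1',
    GenericPsdRank.eq_of_isMax_dotRat x i ω hω hx₂ h2'⟩

/-- **Convex position of a perturbed parabola.** If `|x_i,1 − c_i| < δ` and `|x_i,2 − c_i²| < δ`
with `2(2v+1)δ < 1`, then each `x_j` is the unique maximiser of `2c_j·x₁ − x₂` among the `x_i`
(value `≈ c_j² − (c_i − c_j)²`), hence an extreme point of the hull (printed for the unperturbed
points: "`Z := {(z, z²)}` … obviously convex independent"). [cite: FioriniRothvossTiwary2012, Thm. 8 proof (p09)] -/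
theorem mem_extremePoints_of_near_parabola (x : Fin v → (Fin 2 → ℝ))
    (hx : ∀ i, |x i 0 - ctr i| < rad v ∧ |x i 1 - ctr i ^ 2| < rad v) (j : Fin v) :
    x j ∈ (convexHull ℝ (Set.range x)).extremePoints ℝ := by
  obtain ⟨hδ, hδ1, -⟩ := rad_bounds v
  refine mem_extremePoints_of_strict x j ![2 * (((j : ℕ) : ℚ) + 1), -1] fun i hij => ?_
  have hdot : ∀ l : Fin v, GenericPsdRank.dotRat ![2 * (((j : ℕ) : ℚ) + 1), -1] (x l) =
      2 * ctr j * x l 0 - x l 1 := fun l => by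
    simp only [GenericPsdRank.dotRat, Fin.sum_univ_two, Matrix.cons_val_zero, Matrix.cons_val_one,
      ctr]
    push_cast
    ring
  rw [hdot, hdot]
  obtain ⟨hi0, hi1⟩ := hx i
  obtain ⟨hj0, hj1⟩ := hx j
  rw [abs_lt] at hi0 hi1 hj0 hj1
  have hcj : 0 < ctr j := by unfold ctr; positivity
  have hcjv : ctr j ≤ v := by
    unfold ctr; exact_mod_cast Nat.succ_le_of_lt j.2
  -- `(c_i - c_j)² ≥ 1`
  have hsq : 1 ≤ ctr i ^ 2 - 2 * ctr i * ctr j + ctr j ^ 2 := by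
    have hne : (i : ℕ) ≠ (j : ℕ) := fun h => hij (Fin.ext h)
    have h1 : 1 ≤ |ctr i - ctr j| := by
      unfold ctr
      rcases Nat.lt_or_gt_of_ne hne with h | h
      · have : (i : ℝ) + 1 ≤ j := by exact_mod_cast h
        rw [abs_of_neg (by linarith)]; linarith
      · have : (j : ℝ) + 1 ≤ i := by exact_mod_cast h
        rw [abs_of_pos (by linarith)]; linarith
    nlinarith [abs_nonneg (ctr i - ctr j), sq_abs (ctr i - ctr j)]
  have h1 : 2 * ctr j * x i 0 ≤ 2 * ctr j * ctr i + 2 * ctr j * rad v := by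
    have := mul_le_mul_of_nonneg_left (show x i 0 ≤ ctr i + rad v by linarith) (le_of_lt (by positivity : (0:ℝ) < 2 * ctr j))
    linarith
  have h2 : 2 * ctr j * ctr j - 2 * ctr j * rad v ≤ 2 * ctr j * x j 0 := by
    have := mul_le_mul_of_nonneg_left (show ctr j - rad v ≤ x j 0 by linarith) (le_of_lt (by positivity : (0:ℝ) < 2 * ctr j))
    linarith
  have h3 : 2 * ctr j * rad v + rad v < 1 / 2 := by
    have := mul_le_mul_of_nonneg_right hcjv hδ.le
    nlinarith
  nlinarith [hsq, h1, h2, h3, hi1.1, hj1.2]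

/-- **Full-dimensional hull**: three perturbed parabola points near `(1,1), (2,4), (3,9)` are affinely
independent (`det ≈ 2`), so the hull of the family has nonempty interior (GRT Thm. 2.1 is about
polytopes `P ⊂ ℝⁿ`, i.e. full-dimensional). [cite: GouveiaRobinsonThomas2015, §2 (p05)] -/
theorem interior_nonempty_of_near_parabola (hv : 3 ≤ v) (x : Fin v → (Fin 2 → ℝ))
    (hx : ∀ i, |x i 0 - ctr i| < rad v ∧ |x i 1 - ctr i ^ 2| < rad v) :
    (interior (convexHull ℝ (Set.range x))).Nonempty := by
  obtain ⟨hδ, -, -⟩ := rad_bounds v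
  have hδ16 : rad v ≤ 1 / 16 := by
    unfold rad
    apply one_div_le_one_div_of_le (by norm_num)
    have : (3 : ℝ) ≤ v := by exact_mod_cast hv
    linarith
  haveI : Nonempty (Fin v) := ⟨⟨0, by omega⟩⟩
  set i₀ : Fin v := ⟨0, by omega⟩
  set i₁ : Fin v := ⟨1, by omega⟩
  set i₂ : Fin v := ⟨2, by omega⟩
  have hc0 : ctr i₀ = 1 := by simp [ctr, i₀]
  have hc1 : ctr i₁ = 2 := by simp [ctr, i₁]; norm_num
  have hc2 : ctr i₂ = 3 := by simp [ctr, i₂]; norm_num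
  obtain ⟨h00, h01⟩ := hx i₀
  obtain ⟨h10, h11⟩ := hx i₁
  obtain ⟨h20, h21⟩ := hx i₂
  rw [hc0] at h00 h01
  rw [hc1] at h10 h11
  rw [hc2] at h20 h21
  rw [abs_lt] at h00 h01 h10 h11 h20 h21
  set u : Fin 2 → ℝ := x i₁ - x i₀ with hu
  set w : Fin 2 → ℝ := x i₂ - x i₀ with hw
  set D : ℝ := u 0 * w 1 - u 1 * w 0 with hD
  have hu0 : 1 - 2 * rad v ≤ u 0 := by simp only [hu, Pi.sub_apply]; linarith
  have hw1 : 8 - 2 * rad v ≤ w 1 := by simp only [hw, Pi.sub_apply]; nlinarith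
  have hu1 : u 1 ≤ 3 + 2 * rad v := by simp only [hu, Pi.sub_apply]; nlinarith
  have hu1' : 0 ≤ u 1 := by simp only [hu, Pi.sub_apply]; nlinarith
  have hw0 : w 0 ≤ 2 + 2 * rad v := by simp only [hw, Pi.sub_apply]; linarith
  have hw0' : 0 ≤ w 0 := by simp only [hw, Pi.sub_apply]; linarith
  have hDpos : 0 < D := by
    have h1 : (1 - 2 * rad v) * (8 - 2 * rad v) ≤ u 0 * w 1 :=
      mul_le_mul hu0 hw1 (by linarith) (by linarith)
    have h2 : u 1 * w 0 ≤ (3 + 2 * rad v) * (2 + 2 * rad v) :=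
      mul_le_mul hu1 hw0 hw0' (by linarith)
    rw [hD]; nlinarith
  have hD0 : D ≠ 0 := hDpos.ne'
  -- `vectorSpan = ⊤`
  have huV : u ∈ vectorSpan ℝ (Set.range x) :=
    vsub_mem_vectorSpan ℝ (Set.mem_range_self i₁) (Set.mem_range_self i₀)
  have hwV : w ∈ vectorSpan ℝ (Set.range x) :=
    vsub_mem_vectorSpan ℝ (Set.mem_range_self i₂) (Set.mem_range_self i₀)
  have hVS : vectorSpan ℝ (Set.range x) = ⊤ := by
    rw [Submodule.eq_top_iff']
    intro z
    set α : ℝ := (z 0 * w 1 - z 1 * w 0) / D with hα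
    set β : ℝ := (u 0 * z 1 - u 1 * z 0) / D with hβ
    have e0 : α * u 0 + β * w 0 = z 0 := by
      rw [hα, hβ, div_mul_eq_mul_div, div_mul_eq_mul_div, ← add_div, div_eq_iff hD0, hD]
      ring
    have e1 : α * u 1 + β * w 1 = z 1 := by
      rw [hα, hβ, div_mul_eq_mul_div, div_mul_eq_mul_div, ← add_div, div_eq_iff hD0, hD]
      ring
    have hz : z = α • u + β • w := by
      funext l
      fin_cases l
      · simpa using e0.symm
      · simpa using e1.symm
    rw [hz]
    exact Submodule.add_mem _ (Submodule.smul_mem _ _ huV) (Submodule.smul_mem _ _ hwV)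
  have hAS : affineSpan ℝ (Set.range x) = ⊤ :=
    (AffineSubspace.affineSpan_eq_top_iff_vectorSpan_eq_top_of_nonempty ℝ _ _
      (Set.range_nonempty x)).2 hVS
  exact interior_convexHull_nonempty_iff_affineSpan_eq_top.2 hAS

/-- **Generic convex polygons exist.** For every `v ≥ 3` there are `v` points of `ℝ²` whose `2v`
coordinates are algebraically independent over `ℚ`, in convex position, with full-dimensional hull
(a generic convex `v`-gon in the sense of FRT §4 / GRT §2). [cite: GouveiaRobinsonThomas2015, §3 (p06: "the worst case rank of a `v`-gon")] -/
theorem exists_generic_convexPolygon (hv : 3 ≤ v) :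
    ∃ x : Fin v → (Fin 2 → ℝ),
      AlgebraicIndependent ℚ (fun p : Fin v × Fin 2 => x p.1 p.2) ∧
      Function.Injective x ∧
      (∀ i, x i ∈ (convexHull ℝ (Set.range x)).extremePoints ℝ) ∧
      (interior (convexHull ℝ (Set.range x))).Nonempty := by
  obtain ⟨hδ, -, -⟩ := rad_bounds v
  set e : Fin v × Fin 2 ≃ Fin (v * 2) := finProdFinEquiv
  obtain ⟨t, ht, htI⟩ := exists_algebraicIndependent_mem_Ioo (v * 2)
    (fun q => tgt (e.symm q) - rad v) (fun q => tgt (e.symm q) + rad v) (fun q => by linarith)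
  set x : Fin v → (Fin 2 → ℝ) := fun i l => t (e (i, l)) with hxdef
  have hind : AlgebraicIndependent ℚ (fun p : Fin v × Fin 2 => x p.1 p.2) := by
    have : (fun p : Fin v × Fin 2 => x p.1 p.2) = t ∘ e := by funext p; rfl
    rw [this]
    exact (algebraicIndependent_equiv e).2 ht
  have hnear : ∀ i, |x i 0 - ctr i| < rad v ∧ |x i 1 - ctr i ^ 2| < rad v := by
    intro i
    have h0 := htI (e (i, 0))
    have h1 := htI (e (i, 1))
    simp only [Equiv.symm_apply_apply, tgt, Set.mem_Ioo] at h0 h1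
    simp only [↓reduceIte] at h0
    simp only [Fin.one_eq_zero_iff, OfNat.ofNat_ne_one, ↓reduceIte] at h1
    constructor <;> rw [abs_lt] <;> constructor <;> simp only [hxdef] <;> linarith [h0.1, h0.2, h1.1, h1.2]
  have hext : ∀ i, x i ∈ (convexHull ℝ (Set.range x)).extremePoints ℝ :=
    mem_extremePoints_of_near_parabola x hnear
  have hinj : Function.Injective x := fun i j hij => by
    have h := hind.injective (show (fun p : Fin v × Fin 2 => x p.1 p.2) (i, 0) =
        (fun p : Fin v × Fin 2 => x p.1 p.2) (j, 0) by simp only [hij])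
    exact (Prod.ext_iff.1 h).1
  exact ⟨x, hind, hinj, hext, interior_nonempty_of_near_parabola hv x hnear⟩

end GenericPolygon

open GenericPolygon in
/-- **GRT 2015, worst-case psd rank of `v`-gons** (§3 p06: "the psd rank of a generic `v`-gon is at
least `(2v)^{1/4}` … This tells us that the worst case rank of a `v`-gon lies somewhere between the
two"). For every `v ≥ 3` there is a convex `v`-gon (`v` distinct points of `ℝ²` in convex position,
full-dimensional hull) ALL of whose psd lifts have size `k` with `(2v)^{1/4} ≤ k`, indeed
`√(2v) ≤ C(k+1, 2)` (Thm. 2.1 and its printed intermediate count, the tree's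
`GouveiaRobinsonThomas2015_thm21_holds` / `_sharp`, at a generic convex `v`-gon).
[cite: GouveiaRobinsonThomas2015, Thm. 2.1 (p05) and §3 (p06)] -/
theorem exists_polygon_psdRank_ge {v : ℕ} (hv : 3 ≤ v) :
    ∃ x : Fin v → (Fin 2 → ℝ), Function.Injective x ∧
      (∀ i, x i ∈ (convexHull ℝ (Set.range x)).extremePoints ℝ) ∧
      (interior (convexHull ℝ (Set.range x))).Nonempty ∧
      ∀ k : ℕ, HasPsdLift (convexHull ℝ (Set.range x)) k →
        (2 * (v : ℝ)) ^ (1 / 4 : ℝ) ≤ k ∧ Real.sqrt (2 * v) ≤ (k + 1).choose 2 := by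
  obtain ⟨x, hind, hinj, hext, hint⟩ := exists_generic_convexPolygon hv
  refine ⟨x, hinj, hext, hint, fun k hk => ⟨?_, ?_⟩⟩
  · have h := GouveiaRobinsonThomas2015_thm21_holds 2 v x hind hext hint k hk
    exact_mod_cast h
  · have h := GouveiaRobinsonThomas2015_thm21_sharp 2 v x hind hext hint k hk
    exact_mod_cast h

open GenericPolygon Literature.Barriers.PneNP in
/-- **FRT 2012 Theorem 3, worst case**: for every `v ≥ 3` there is a convex `v`-gon all of whose
(slack-form) extended formulations have at least `√(2v)` inequalities — Theorem 3 (the tree's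
`FioriniRothvossTiwary2012_thm3`) at a generic convex `v`-gon, which exists.
[cite: FioriniRothvossTiwary2012, Thm. 3 (§4, p07)] -/
theorem exists_polygon_xc_ge {v : ℕ} (hv : 3 ≤ v) :
    ∃ x : Fin v → (Fin 2 → ℝ), Function.Injective x ∧
      (∀ i, x i ∈ (convexHull ℝ (Set.range x)).extremePoints ℝ) ∧
      (interior (convexHull ℝ (Set.range x))).Nonempty ∧
      ∀ r : ℕ, HasEFOfSize (convexHull ℝ (Set.range x)) r → Real.sqrt (2 * v) ≤ r := by
  obtain ⟨x, hind, hinj, hext, hint⟩ := exists_generic_convexPolygon hv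
  exact ⟨x, hinj, hext, hint, fun r hr => FioriniRothvossTiwary2012_thm3 v x hind hext hint r hr⟩

open GenericPolygon in
/-- **The generic 129-gon** (§3 p07: "the smallest 'concrete' polygons known to have psd rank
greater than four are the generic polytopes whose lower bounds are guaranteed by Theorem 2.1, which
in this case is a generic 129-gon"): a convex 129-gon with NO psd lift of size `≤ 4`
(`2 · 129 = 258 > 256 = 4⁴`, the tree's `GenericPsdRank.mul_le_pow_four`).
[cite: GouveiaRobinsonThomas2015, §3 (p07)] -/
theorem exists_129gon_five_le :
    ∃ x : Fin 129 → (Fin 2 → ℝ), Function.Injective x ∧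
      (∀ i, x i ∈ (convexHull ℝ (Set.range x)).extremePoints ℝ) ∧
      ∀ k : ℕ, HasPsdLift (convexHull ℝ (Set.range x)) k → 5 ≤ k := by
  obtain ⟨x, hind, hinj, hext, hint⟩ := exists_generic_convexPolygon (v := 129) (by norm_num)
  refine ⟨x, hinj, hext, fun k hk => ?_⟩
  have h := GenericPsdRank.mul_le_pow_four (by norm_num) x hind hext hint hk
  by_contra hlt
  have hk4 : k ≤ 4 := by omega
  have : k ^ 4 ≤ 4 ^ 4 := Nat.pow_le_pow_left hk4 4
  omega

open GenericPolygon in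
/-- The same 129-gon through the printed intermediate count `nv ≤ C(k+1,2)²` (the tree's
`GenericPsdRank.mul_le_choose_sq`): no psd lift of size `≤ 5` either (`C(6,2)² = 225 < 258`).
[cite: GouveiaRobinsonThomas2015, Thm. 2.1 proof (p05, "`nv ≤ |Γ| ≤ d_k²`") and §3 (p07)] -/
theorem exists_129gon_six_le :
    ∃ x : Fin 129 → (Fin 2 → ℝ), Function.Injective x ∧
      (∀ i, x i ∈ (convexHull ℝ (Set.range x)).extremePoints ℝ) ∧
      ∀ k : ℕ, HasPsdLift (convexHull ℝ (Set.range x)) k → 6 ≤ k := by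
  obtain ⟨x, hind, hinj, hext, hint⟩ := exists_generic_convexPolygon (v := 129) (by norm_num)
  refine ⟨x, hinj, hext, fun k hk => ?_⟩
  have h := GenericPsdRank.mul_le_choose_sq (by norm_num) x hind hext hint hk
  by_contra hlt
  have hk5 : k + 1 ≤ 6 := by omega
  have h1 : (k + 1).choose 2 ≤ Nat.choose 6 2 := Nat.choose_le_choose 2 hk5
  have h2 : Nat.choose 6 2 = 15 := by decide
  have h3 : ((k + 1).choose 2) ^ 2 ≤ 15 ^ 2 := by
    rw [h2] at h1; exact Nat.pow_le_pow_left h1 2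
  omega

open GenericPolygon in
/-- By the printed intermediate count `nv ≤ C(k+1,2)²` already a generic **51-gon** has no psd lift
of size `≤ 4` (`2·51 = 102 > 100 = C(5,2)²`; the printed remark p07 uses `(nv)^{1/4}` and a
129-gon). [cite: GouveiaRobinsonThomas2015, Thm. 2.1 proof (p05, "`nv ≤ |Γ| ≤ d_k²`") and §3 (p07)] -/
theorem exists_51gon_five_le :
    ∃ x : Fin 51 → (Fin 2 → ℝ), Function.Injective x ∧
      (∀ i, x i ∈ (convexHull ℝ (Set.range x)).extremePoints ℝ) ∧
      ∀ k : ℕ, HasPsdLift (convexHull ℝ (Set.range x)) k → 5 ≤ k := by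
  obtain ⟨x, hind, hinj, hext, hint⟩ := exists_generic_convexPolygon (v := 51) (by norm_num)
  refine ⟨x, hinj, hext, fun k hk => ?_⟩
  have h := GenericPsdRank.mul_le_choose_sq (by norm_num) x hind hext hint hk
  by_contra hlt
  have hk4 : k + 1 ≤ 5 := by omega
  have h1 : (k + 1).choose 2 ≤ Nat.choose 5 2 := Nat.choose_le_choose 2 hk4
  have h2 : Nat.choose 5 2 = 10 := by decide
  have h3 : ((k + 1).choose 2) ^ 2 ≤ 10 ^ 2 := by
    rw [h2] at h1; exact Nat.pow_le_pow_left h1 2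
  omega

/-! ### Slack-matrix readings of the generic lower bounds -/

/-- **GRT 2015 Theorem 2.1 in slack-matrix language** (FGPRT Thm. 3.3 = the tree's
`FawziEtAl2015_thm33_holds`: for polytopes the psd rank of ANY slack matrix equals the least size of
a psd lift): for a generic full-dimensional polytope with `v` vertices in `ℝⁿ` and every
H-description `conv{x_i} = {y : a_jᵀy ≤ b_j}`, every psd factorization of the slack matrix
`(b_j − a_jᵀx_i)` of size `k ≥ 1` has `(nv)^{1/4} ≤ k` (and `√(nv) ≤ C(k+1,2)`).
[cite: GouveiaRobinsonThomas2015, Thm. 2.1 (p05: "its psd rank is at least `(nv)^{1/4}`")] -/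
theorem GouveiaRobinsonThomas2015_thm21_slack (n v : ℕ) (x : Fin v → (Fin n → ℝ))
    (hind : AlgebraicIndependent ℚ fun p : Fin v × Fin n => x p.1 p.2)
    (hext : ∀ i, x i ∈ (convexHull ℝ (Set.range x)).extremePoints ℝ)
    (hint : (interior (convexHull ℝ (Set.range x))).Nonempty)
    {f k : ℕ} (a : Fin f → (Fin n → ℝ)) (b : Fin f → ℝ) (hk : 1 ≤ k)
    (hdesc : convexHull ℝ (Set.range x) = {y | ∀ j, a j ⬝ᵥ y ≤ b j})
    (hfac : HasPsdFactorization (pairSlackMatrix x a b) k) :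
    ((n : ℝ) * v) ^ (1 / 4 : ℝ) ≤ k ∧ Real.sqrt (n * v) ≤ (k + 1).choose 2 := by
  have hlift : HasPsdLift (convexHull ℝ (Set.range x)) k :=
    (FawziEtAl2015_thm33_holds n v f k x a b hk hdesc).1 hfac
  exact ⟨GouveiaRobinsonThomas2015_thm21_holds n v x hind hext hint k hlift,
    GouveiaRobinsonThomas2015_thm21_sharp n v x hind hext hint k hlift⟩

open Literature.Barriers.PneNP in
/-- **FRT 2012 Theorem 3 in slack-matrix language** (their Thm. 1, Yannakakis `xc(P) = rank₊(S(P))`;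
the tree's `hasEFOfSize_of_complete_nonneg_factorization`): for a generic convex `v`-gon and every
H-description `conv{x_i} = {y : a_jᵀy ≤ b_j}`, every nonnegative factorization
`b_j − a_jᵀx_i = Σ_{l<k} U_{jl} W_{il}` of the slack matrix has `√(2v) ≤ k`.
[cite: FioriniRothvossTiwary2012, Thm. 3 (§4 p07) and Thm. 1 (§2 p04)] -/
theorem FioriniRothvossTiwary2012_thm3_nonnegRank (v : ℕ) (x : Fin v → (Fin 2 → ℝ))
    (hind : AlgebraicIndependent ℚ fun p : Fin v × Fin 2 => x p.1 p.2)
    (hext : ∀ i, x i ∈ (convexHull ℝ (Set.range x)).extremePoints ℝ)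
    (hint : (interior (convexHull ℝ (Set.range x))).Nonempty)
    {f k : ℕ} (a : Fin f → (Fin 2 → ℝ)) (b : Fin f → ℝ)
    (U : Fin f → Fin k → ℝ) (W : Fin v → Fin k → ℝ)
    (hdesc : convexHull ℝ (Set.range x) = {y | ∀ j, a j ⬝ᵥ y ≤ b j})
    (hU : ∀ j l, 0 ≤ U j l) (hW : ∀ i l, 0 ≤ W i l)
    (hfac : ∀ j i, b j - a j ⬝ᵥ x i = ∑ l, U j l * W i l) :
    Real.sqrt (2 * v) ≤ k := by
  have hEF := hasEFOfSize_of_complete_nonneg_factorization x a b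
    (fun y hy => by rw [hdesc]; exact hy) U W hU hW hfac
  rw [Fintype.card_fin] at hEF
  exact FioriniRothvossTiwary2012_thm3 v x hind hext hint k hEF

open GenericPolygon in
/-- **Worst case, slack-matrix language**: for every `v ≥ 3` a convex `v`-gon such that, for every
H-description, every psd factorization of the slack matrix has size `k ≥ (2v)^{1/4}` (`k ≥ 1`) and
every nonnegative factorization has `≥ √(2v)` columns.
[cite: GouveiaRobinsonThomas2015, §3 (p06)] [cite: FioriniRothvossTiwary2012, Thm. 3 (§4 p07)] -/
theorem exists_polygon_slack_ranks_ge {v : ℕ} (hv : 3 ≤ v) :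
    ∃ x : Fin v → (Fin 2 → ℝ), Function.Injective x ∧
      (∀ i, x i ∈ (convexHull ℝ (Set.range x)).extremePoints ℝ) ∧
      (∀ (f k : ℕ) (a : Fin f → (Fin 2 → ℝ)) (b : Fin f → ℝ), 1 ≤ k →
        convexHull ℝ (Set.range x) = {y | ∀ j, a j ⬝ᵥ y ≤ b j} →
        HasPsdFactorization (pairSlackMatrix x a b) k → (2 * (v : ℝ)) ^ (1 / 4 : ℝ) ≤ k) ∧
      (∀ (f k : ℕ) (a : Fin f → (Fin 2 → ℝ)) (b : Fin f → ℝ)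
        (U : Fin f → Fin k → ℝ) (W : Fin v → Fin k → ℝ),
        convexHull ℝ (Set.range x) = {y | ∀ j, a j ⬝ᵥ y ≤ b j} →
        (∀ j l, 0 ≤ U j l) → (∀ i l, 0 ≤ W i l) →
        (∀ j i, b j - a j ⬝ᵥ x i = ∑ l, U j l * W i l) → Real.sqrt (2 * v) ≤ k) := by
  obtain ⟨x, hind, hinj, hext, hint⟩ := exists_generic_convexPolygon hv
  refine ⟨x, hinj, hext, fun f k a b hk hdesc hfac => ?_,
    fun f k a b U W hdesc hU hW hfac => ?_⟩
  · have h := (GouveiaRobinsonThomas2015_thm21_slack 2 v x hind hext hint a b hk hdesc hfac).1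
    exact_mod_cast h
  · exact FioriniRothvossTiwary2012_thm3_nonnegRank v x hind hext hint a b U W hdesc hU hW hfac

end Literature.Combinatorics.Optimization

end
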